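import Summits.CriticalPhenomena.PercolationContinuityZ3.Theorems.Transplant.HexShadowEq12
import HarnessLib

/-!
# The triangular films `𝕋 × {0..k}` in the scope of Conjecture 4: quasi-transitive (`k+1` orbits of the planar translations), cubic growth, amenable,
# UNIQUE infinite cluster (Burton–Keane) — and `θ_v(p_c) = 0` on `𝕋 × {0..k}` modulo the hexagonal Gluing Lemma ALONE

builds on p205010 (kernel theorem, internal audit signed; external expert review pending) — NOT used in this file.  Lane `prim-bschramm`, seat
`prim-bschramm-p2` (gen 32; class C1b; memo §114, §118); helper file (`--supports stmt-CriticalPhenomena-4575 --as helper`).  Pattern: «Slab111Scope» §1–§2 and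
«StackedTriangularScope» (whose coordinate bounds are reused).
* §1 `TriFilm.rep/types`, `exists_liftIso_mem_types`, **`TriFilm.isQuasiTransitive`**; §2 `abs_sub_le_length`, **`ballVolume_le : |B(x,n)| ≤ (2n+1)³`**,
  `not_hasExponentialGrowth`, **`isGraphAmenable`**, **`numInfiniteClusters_le_one`** (Burton–Keane, tree);
* §3 **`TriFilm.theta_criticalProb_eq_zero_of_hexGluing'`**: `(TriFilm.hexShadow k).HexGluing → θ_v(p_c) = 0` at every vertex of `𝕋 × {0..k}` (every `k`).
[cite: BenjaminiSchramm1996, Conj. 4 / Question 3] [cite: LyonsPeres2016, §6.1, Thm. 7.6] [cite: BurtonKeane1989, Thm. 2] [cite: DuminilCopinSidoraviciusTassion2016, Thm. 1, Lemma 6]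
-/

noncomputable section

namespace Summit.CriticalPhenomena.PercolationContinuityZ3.Theorems.Transplant

open MeasureTheory Filter Literature.Probability.Percolation Literature.Probability.LatticeModels SimpleGraph
open Literature.Barriers.CriticalPhenomena (IsQuasiTransitive IsGraphAmenable HasExponentialGrowth graphBall ballVolume graphBall_finite
  hasExponentialGrowth_of_not_isGraphAmenable eventually_pow_lt_const_pow BurtonKeane1989_atMostOneInfiniteCluster_holds)
open scoped Classical

namespace TriFilm

/-! ## §1 Quasi-transitivity -/

/-- The layer-`j` representative `(0, j)`, `j ≤ k`. [folklore] -/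
def rep (k : ℕ) (j : Fin (k + 1)) : triFilm k := ⟨((0 : Site 2), ![((j : ℕ) : ℤ)]), by rw [mem_triFilm]; simp; omega⟩

/-- The finite set of orbit representatives. [folklore] -/
def types (k : ℕ) : Finset (triFilm k) := Finset.univ.image (rep k)

/-- **Every film vertex is carried to the representative of its layer by a lifted planar translation.** [folklore] -/
theorem exists_liftIso_mem_types (k : ℕ) (v : triFilm k) : ∃ γ : film k ≃g film k, γ v ∈ types k := by
  have hv := mem_triFilm.1 v.2
  set j : ℕ := ((v : Site 2 × Site 1).2 0).toNat with hj
  have hjk : j < k + 1 := by omega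
  have hjv : ((j : ℕ) : ℤ) = (v : Site 2 × Site 1).2 0 := by omega
  refine ⟨liftIso k (triShiftIso (-(v : Site 2 × Site 1).1)), ?_⟩
  rw [types, Finset.mem_image]
  refine ⟨⟨j, hjk⟩, Finset.mem_univ _, Subtype.ext (Prod.ext ?_ ?_)⟩
  · rw [liftIso_coe_fst, triShiftIso_apply]; simp [rep]
  · change ((rep k ⟨j, hjk⟩ : triFilm k) : Site 2 × Site 1).2 = (v : Site 2 × Site 1).2
    ext i; fin_cases i
    simp [rep, hjv]

/-- **The triangular film is quasi-transitive** (`k + 1` orbits). [cite: BenjaminiSchramm1996, §2 (quasi-transitive graphs)] -/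
theorem isQuasiTransitive (k : ℕ) : IsQuasiTransitive (film k) := ⟨types k, exists_liftIso_mem_types k⟩

/-! ## §2 Cubic growth, amenability, uniqueness of the infinite cluster -/

/-- Along a walk of length `n` in the film each of the three coordinates moves by at most `n`. [folklore] -/
theorem abs_sub_le_length {k : ℕ} {x y : triFilm k} (w : (film k).Walk x y) (i : Fin 3) :
    |stackedCoords (y : Site 2 × Site 1) i - stackedCoords (x : Site 2 × Site 1) i| ≤ (w.length : ℤ) := by
  induction w with
  | nil => simp
  | @cons a b c hab w ih =>
    have hab' : stackedTriangularGraph.Adj (a : Site 2 × Site 1) b := hab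
    have h1 : |stackedCoords (b : Site 2 × Site 1) i - stackedCoords (a : Site 2 × Site 1) i| ≤ 1 := by
      rw [abs_sub_comm]; exact stackedTriangular_abs_sub_le_one hab' i
    have h2 := abs_sub_le (stackedCoords (c : Site 2 × Site 1) i) (stackedCoords (b : Site 2 × Site 1) i) (stackedCoords (a : Site 2 × Site 1) i)
    simp only [SimpleGraph.Walk.length_cons, Nat.cast_add, Nat.cast_one]
    linarith

/-- **Cubic growth of the film**: `|B(x,n)| ≤ (2n+1)³`. [cite: LyonsPeres2016, §6.1 (growth of balls)] -/
theorem ballVolume_le {k : ℕ} (x : triFilm k) (n : ℕ) : ballVolume (film k) x n ≤ (2 * n + 1) ^ 3 := by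
  set f : triFilm k → Site 3 := fun y => stackedCoords (y : Site 2 × Site 1) - stackedCoords (x : Site 2 × Site 1) with hf
  have hinj : Function.Injective f := fun y z h => Subtype.ext (stackedCoords_injective (sub_left_injective h))
  have hsub : f '' graphBall (film k) x n ⊆ (↑(box 3 n) : Set (Site 3)) := by
    rintro _ ⟨y, ⟨w, hw⟩, rfl⟩
    rw [Finset.mem_coe, mem_box]
    intro i
    have h := abs_sub_le_length w i
    have hn : (w.length : ℤ) ≤ n := by exact_mod_cast hw
    simp only [hf, Pi.sub_apply]
    constructor <;> linarith [(abs_le.1 (h.trans hn)).1, (abs_le.1 (h.trans hn)).2]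
  unfold ballVolume
  rw [← Set.ncard_image_of_injective _ hinj, ← card_box 3 n, ← Set.ncard_coe_finset]
  exact Set.ncard_le_ncard hsub (box 3 n).finite_toSet

/-- The film does not have exponential growth. [cite: Hutchcroft2016, Thm. 1 (hypothesis fails)] -/
theorem not_hasExponentialGrowth (k : ℕ) : ¬ HasExponentialGrowth (film k) := by
  intro h
  obtain ⟨c, hc, hev⟩ := h (rep k 0)
  obtain ⟨n, hn1, hn2⟩ := (hev.and (eventually_pow_lt_const_pow 3 hc)).exists
  have hvol : (ballVolume (film k) (rep k 0) n : ℝ) ≤ (2 * n + 1) ^ 3 := by exact_mod_cast ballVolume_le _ n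
  linarith

/-- **The film is amenable** (subexponential growth + quasi-transitivity). [cite: LyonsPeres2016, §6.1 (p. 279)] -/
theorem isGraphAmenable (k : ℕ) : IsGraphAmenable (film k) := by
  by_contra h
  exact not_hasExponentialGrowth k (hasExponentialGrowth_of_not_isGraphAmenable _ (isQuasiTransitive k) h)

/-- **Uniqueness of the infinite cluster on `𝕋 × {0..k}` at every `p`** (Burton–Keane, tree). [cite: BurtonKeane1989, Thm. 2] [cite: LyonsPeres2016, Thm. 7.6] -/
theorem numInfiniteClusters_le_one (k : ℕ) (p : unitInterval) : ∀ᵐ ω ∂(bondPercolation (film k) p), numInfiniteClusters ω ≤ 1 :=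
  BurtonKeane1989_atMostOneInfiniteCluster_holds _ (connected k) (isQuasiTransitive k) (isGraphAmenable k) p

/-! ## §3 `θ_v(p_c) = 0` on `𝕋 × {0..k}` modulo the hexagonal Gluing Lemma alone -/

/-- **THE TRIANGULAR FILMS MODULO THE HEXAGONAL GLUING LEMMA**: for every `k` and every vertex `v` of `𝕋 × {0..k}`, if DST's Gluing Lemma holds for the film's
hexagonal shadow then `θ_v(p_c) = 0`.  (Eq. (1), Lemmata 4–5, eqs. (10)–(13), §2.2, the assembly, Fact 1 and the surgery core are proved in the tree; a.s.
uniqueness is `numInfiniteClusters_le_one`.) [cite: DuminilCopinSidoraviciusTassion2016, Thm. 1, Lemma 6] [cite: BenjaminiSchramm1996, Conj. 4 / Question 3] -/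
theorem theta_criticalProb_eq_zero_of_hexGluing' (k : ℕ) (h6 : (hexShadow k).HexGluing) (v : triFilm k) :
    theta (film k) v (criticalProbIOf (film k) v) = 0 :=
  theta_criticalProb_eq_zero_of_hexGluing k (numInfiniteClusters_le_one k) h6 v

end TriFilm

end Summit.CriticalPhenomena.PercolationContinuityZ3.Theorems.Transplant

end
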